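import Summits.QuantumFields.YangMills.Theorems.AlphaInputsT3ACv3StartT3
import Summits.QuantumFields.YangMills.Theorems.AlphaInputsT3ACv3StartShell
import Summits.QuantumFields.YangMills.Theorems.AlphaInputsT3ACv3StartLine
import Summits.QuantumFields.YangMills.Theorems.AlphaInputsT3ACv3StartRowsLine
import Summits.QuantumFields.YangMills.Theorems.AlphaInputsT3ACv3StartDefectTwoCell
import Literature.MathematicalPhysics.QuantumFieldTheory.Balaban1983to89.B10Eq42TorusConstraint
import HarnessLib

/-!
# `AlphaInputsT3ACv3StartCert` — START v3.1 for the (FL) `hLift` binder: **THE START CERTIFICATE ON THE THREE-TORUS** — for the canonical start field `U₀ := startT3 F K k Ω V b` with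
# `b := exp((2r+1)⁻²·2ε′) − 1` (the tube budget): ★★★ `startT3_cert`: (P) every constrained plaquette `q ∈ plaqsIn 0 Ω` has `dist1 U₀(∂q) ≤ δ₀ := max(b, 81601·b)`, and (D) every
# constrained coarse bond `c ∈ bondsIn k Ω` has `‖Ū₀^{(k)}(c)·V(c)* − 1‖ ≤ 2(d+1)L^k·((d⌊L^k∕2⌋ + L^k)·δ₀)` — from `dist1 V(∂Q) ≤ ε′ ≤ 10⁻⁵` on `plaqsIn k Ω`, `16 ≤ L^k`,
# `4L^k ≤ N₀`, `|n| = 2`, the DISPLAYED lattice binders of (S5)-4b (constrained + shell + two-cell) and the three (S6) smallness rows; numerals: `δ₀ ≤ 83559424·ε′∕(L^k)²`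
# (`startBound_le`), `η₀ ≤ 20·83559424·ε′` (★w5 `eta0_le_of_boxBound`) — lane `pub-balaban3d` ∕ cell `ym3-torus`, seat `ym-ust-19936-w1` (g2, LEAD)

WHY (OWNER 03:44:03Z (J): ★w4 g2 types the M22 skeleton `hLift_clause_of_start` from DISPLAYED START rows + (K1)–(K7); LEAD supplies the START rows).  THIS FILE is the START side of
that junction, by name: (P) = `dist1_plaqHol_startT3_le` with `hshell` DISCHARGED by `hshell_of_binders` at `b :=` the tube budget (its `htube` from `‖F′_Q‖ ≤ 2ε′`) and the shell
smallness rows DISCHARGED by ★w5's `startRows` (`ε′ ≤ 10⁻⁵`, `16 ≤ L^k`, `|n| = 2`); (D) = ★w5's `StartDefectBox.norm_startDefect_sub_one_le_twoCell` with `hU` from (P) through the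
two-cell binder `htwo` and `hline` DISCHARGED by `startSys_centre_eq_iterSec` (`…StartLine`; rows `RbT_lt_half`, `RtT_add_two_le`, `hN_of_pow_le`, window `hF_of_dist1`).
LEFT DISPLAYED (all lattice∕arithmetic, no analysis): (hbox)(hsep)(hcov) at `q ∈ plaqsIn 0 Ω ∧ ¬Deep` [★w2 ⧗∕19936-w8∕★w5]; their shell twins at `ShellPlaq` [same]; `htwo` (two-cell
plaquettes of a constrained coarse bond are constrained) [same, saturation]; the (S6) rows `hm`∕`h32`∕`hNδ` at `b′ := δ₀` (linear in ε′, L-dependent constants — absorbed by `B₀(L)` per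
FL-SMALL (c′)).
HONEST FRAMING.  Knit; (FL)∕`hLift` NOT proved (the Newton step (E′)∕(H) and the M22 skeleton are ★w4's; the lattice binders are open); count-neutral helper toward R3 2′ (items
19936∕19935); registry untouched; nothing about d = 4, the continuum, or a mass gap; YM₃ on T³ is rung R3, not Clay.

References: T. Bałaban, Commun. Math. Phys. 102 (1985) 277–309 [Balaban1985Variational] (Thm 1 (8) p.279, (11)–(15) pp.279–280); Commun. Math. Phys. 98 (1985) 17–51
[Balaban1985Averaging] ((8)–(9), (12) p.19).
-/

set_option autoImplicit false

noncomputable section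

open scoped Matrix.Norms.L2Operator

namespace Summit.QuantumFields.YangMills.Theorems.TubeStart

open Literature.MathematicalPhysics.QuantumFieldTheory.Balaban1983to89
open T4Continuum BlockAveraging ExpMeanLog
open Literature.MathematicalPhysics.QuantumFieldTheory.Balaban1983to89.T4AdjointCovarianceUnitary (lieSU expSU)
open Literature.MathematicalPhysics.QuantumFieldTheory.Balaban1983to89.BlockAveragingSectionAction (iterSec)
open Literature.MathematicalPhysics.QuantumFieldTheory.Balaban1983to89.B10Eq38TorusDomains (toFine plaqsIn)
open Literature.MathematicalPhysics.QuantumFieldTheory.Balaban1983to89.B10Eq42TorusConstraint (bondsIn)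
open Literature.MathematicalPhysics.QuantumFieldTheory.Balaban1983to89.T3ContinuumYM3Torus (T3Family)
open Summit.QuantumFields.Balaban3D.Carriers
open Summit.QuantumFields.YangMills.Theorems.ModelBox
open Summit.QuantumFields.YangMills.Theorems.Prop7FlatHolonomy (sitesPerDir_zero_eq_mul_pow)
open Summit.QuantumFields.YangMills.Theorems.StartDefectBox (twoCellSet norm_startDefect_sub_one_le_twoCell)

variable (F : T3Family) (K : ℕ) {n : Type*} [Fintype n] [DecidableEq n] [Nonempty n] (k : ℕ) (Ω : Set (Site (F.P K) 0))
  (V : GaugeField (F.P K) k (Matrix.specialUnitaryGroup n ℂ))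

/-- **THE TUBE BUDGET AS A NUMBER**: `b(ε′) := exp((2r+1)⁻²·2ε′) − 1` (★w5 `tubeBound_le`: `≤ 1024ε′∕(L^k)²`). [cite: Balaban1985Variational, (14) p.280] -/
def tubeBd (ε' : ℝ) : ℝ := Real.exp (((2 * (rT (F.P K) k : ℝ) + 1))⁻¹ ^ 2 * (2 * ε')) - 1

/-- **THE START's PLAQUETTE NUMBER** `δ₀(ε′) := max(b, 81601·b)` (`startBound_le`: `≤ 83559424ε′∕(L^k)²`). [cite: Balaban1985Variational, (14) p.280] -/
def startBd (ε' : ℝ) : ℝ := max (tubeBd F K k ε') (81601 * tubeBd F K k ε')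

/-- `δ₀ ≤ 83559424·ε′∕(L^k)²` (`0 ≤ ε′ ≤ 1∕4`, `16 ≤ L^k`). [folklore] -/
theorem startBd_le (hm : 16 ≤ (F.P K).L ^ k) {ε' : ℝ} (hε : 0 ≤ ε') (hε4 : ε' ≤ 1 / 4) : startBd F K k ε' ≤ 83559424 * ε' / (((F.P K).L ^ k : ℕ) : ℝ) ^ 2 :=
  startBound_le (F.P K) k hm hε hε4

/-- `0 ≤ δ₀` (`0 ≤ ε′`). [folklore] -/
theorem startBd_nonneg {ε' : ℝ} (hε : 0 ≤ ε') : 0 ≤ startBd F K k ε' :=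
  le_max_of_le_left (tubeBound_nonneg (F.P K) k hε)

open Classical in
/-- **★★★ THE START CERTIFICATE ON THE THREE-TORUS**: for `U₀ := startT3 F K k Ω V (b ε′)`, (P) `dist1 U₀(∂q) ≤ δ₀` on `plaqsIn 0 Ω` and (D) `‖Ū₀^{(k)}(c)·V(c)* − 1‖ ≤ 2(d+1)L^k·(D·δ₀)`
on `bondsIn k Ω`, `D = d⌊L^k∕2⌋ + L^k`.  Displayed: `k ≤ m+K`, `16 ≤ L^k`, `4L^k ≤ N₀`, `|n| = 2`, `0 ≤ ε′ ≤ 10⁻⁵`, `dist1 V(∂Q) ≤ ε′` on `plaqsIn k Ω`; the lattice binders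
(constrained∕shell∕two-cell); the three (S6) rows at `b′ := δ₀`. [cite: Balaban1985Variational, Thm 1 (8) p.279, (11)–(15) pp.279–280] -/
theorem startT3_cert (hk : k ≤ (F.P K).m + (F.P K).K) (hm : 16 ≤ (F.P K).L ^ k) (hN4 : 4 * (F.P K).L ^ k ≤ (F.P K).sitesPerDir 0) (hn2 : Fintype.card n = 2)
    {ε' : ℝ} (hε0 : 0 ≤ ε') (hε5 : ε' ≤ 1 / 100000) (hV : ∀ Q, Q ∈ plaqsIn k Ω → GaugeGroup.dist1 (GaugeField.plaqHol V Q) ≤ ε')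
    -- lattice binders of (S5)-4b at the constrained, non-deep plaquettes
    (hbox : ∀ Q, IsTubeΩ k Ω Q → ∀ q : Plaq (F.P K) 0, q ∈ plaqsIn 0 Ω → ¬ Plaq.Deep (IsBallΩ k Ω) (fun v b => BallBond v (RbT (F.P K) k) b) q →
      (∃ b, Plaq.HasBond q b ∧ TubeActive V (RtT (F.P K) k) (FpOf k V) (tfOf k Ω) (IsTubeΩ k Ω) Q b) →
      ∃ u : Fin (F.P K).d → ℤ, q.src = boxSite (cornerSite k Q.src Q.μ Q.ν) u ∧ InTube Q.μ Q.ν (RtT (F.P K) k) ((F.P K).L ^ k / 2) u ∧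
        InTube Q.μ Q.ν (RtT (F.P K) k) ((F.P K).L ^ k / 2) (u + e q.μ) ∧ InTube Q.μ Q.ν (RtT (F.P K) k) ((F.P K).L ^ k / 2) (u + e q.ν) ∧
        InTube Q.μ Q.ν (RtT (F.P K) k) ((F.P K).L ^ k / 2) (u + e q.μ + e q.ν))
    (hsep : ∀ Q Q' (q : Plaq (F.P K) 0), q ∈ plaqsIn 0 Ω → ¬ Plaq.Deep (IsBallΩ k Ω) (fun v b => BallBond v (RbT (F.P K) k) b) q →
      (∃ b, Plaq.HasBond q b ∧ TubeActive V (RtT (F.P K) k) (FpOf k V) (tfOf k Ω) (IsTubeΩ k Ω) Q b) →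
      (∃ b, Plaq.HasBond q b ∧ TubeActive V (RtT (F.P K) k) (FpOf k V) (tfOf k Ω) (IsTubeΩ k Ω) Q' b) → Q = Q')
    (hcov : ∀ q : Plaq (F.P K) 0, q ∈ plaqsIn 0 Ω → ¬ Plaq.Deep (IsBallΩ k Ω) (fun v b => BallBond v (RbT (F.P K) k) b) q → GaugeField.plaqHol (iterSec k V) q ≠ 1 →
      ∃ Q b, Plaq.HasBond q b ∧ TubeActive V (RtT (F.P K) k) (FpOf k V) (tfOf k Ω) (IsTubeΩ k Ω) Q b)
    -- their shell twins
    (hbox_sh : ∀ Q, IsTubeΩ k Ω Q → ∀ q : Plaq (F.P K) 0, ShellPlaq k Ω q → (∃ b, Plaq.HasBond q b ∧ TubeActive V (RtT (F.P K) k) (FpOf k V) (tfOf k Ω) (IsTubeΩ k Ω) Q b) →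
      ∃ u : Fin (F.P K).d → ℤ, q.src = boxSite (cornerSite k Q.src Q.μ Q.ν) u ∧ InTube Q.μ Q.ν (RtT (F.P K) k) ((F.P K).L ^ k / 2) u ∧
        InTube Q.μ Q.ν (RtT (F.P K) k) ((F.P K).L ^ k / 2) (u + e q.μ) ∧ InTube Q.μ Q.ν (RtT (F.P K) k) ((F.P K).L ^ k / 2) (u + e q.ν) ∧
        InTube Q.μ Q.ν (RtT (F.P K) k) ((F.P K).L ^ k / 2) (u + e q.μ + e q.ν))
    (hsep_sh : ∀ Q Q' (q : Plaq (F.P K) 0), ShellPlaq k Ω q → (∃ b, Plaq.HasBond q b ∧ TubeActive V (RtT (F.P K) k) (FpOf k V) (tfOf k Ω) (IsTubeΩ k Ω) Q b) →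
      (∃ b, Plaq.HasBond q b ∧ TubeActive V (RtT (F.P K) k) (FpOf k V) (tfOf k Ω) (IsTubeΩ k Ω) Q' b) → Q = Q')
    (hcov_sh : ∀ q : Plaq (F.P K) 0, ShellPlaq k Ω q → GaugeField.plaqHol (iterSec k V) q ≠ 1 →
      ∃ Q b, Plaq.HasBond q b ∧ TubeActive V (RtT (F.P K) k) (FpOf k V) (tfOf k Ω) (IsTubeΩ k Ω) Q b)
    -- the two-cell binder (saturation)
    (htwo : ∀ c : PBond (F.P K) k, c ∈ bondsIn k Ω → ∀ q : Plaq (F.P K) 0, (∀ κ, q.src κ ∈ twoCellSet k c κ) → (∀ κ, ((q.src.shift q.μ).shift q.ν) κ ∈ twoCellSet k c κ) →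
      q ∈ plaqsIn 0 Ω)
    -- the three (S6) rows at `b′ := δ₀`
    (hmS6 : ((((F.P K).d : ℝ) + 1) * ((18 : ℝ) ^ (F.P K).d * (2 + (((F.P K).d : ℝ) + 1) * (18 : ℝ) ^ (F.P K).d)) * (324 * ((((F.P K).d + 2) * (F.P K).L : ℕ) : ℝ) ^ 2) /
        (((F.P K).L : ℝ) * (((F.P K).L : ℝ) - 1))) * ((((F.P K).d : ℝ) + 1) * ((F.P K).L : ℝ) ^ k * (((((F.P K).d * ((F.P K).L ^ k / 2) + (F.P K).L ^ k : ℕ)) : ℝ) * startBd F K k ε')) ≤ 1)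
    (h32 : 32 * ((((F.P K).d + 2) * (F.P K).L : ℕ) : ℝ) * ((((F.P K).d : ℝ) + 1) * ((F.P K).L : ℝ) ^ k * (((((F.P K).d * ((F.P K).L ^ k / 2) + (F.P K).L ^ k : ℕ)) : ℝ) * startBd F K k ε')) ≤ 1)
    (hNδ : 4 * ((((F.P K).d + 2) * (F.P K).L : ℕ) : ℝ) * ((((F.P K).d : ℝ) + 1) * ((F.P K).L : ℝ) ^ k * (((((F.P K).d * ((F.P K).L ^ k / 2) + (F.P K).L ^ k : ℕ)) : ℝ) * startBd F K k ε')) < deltaSU n) :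
    (∀ q : Plaq (F.P K) 0, q ∈ plaqsIn 0 Ω → GaugeGroup.dist1 (GaugeField.plaqHol (startT3 F K k Ω V (tubeBd F K k ε')) q) ≤ startBd F K k ε') ∧
    (∀ c : PBond (F.P K) k, c ∈ bondsIn k Ω →
      ‖((Averaging.iter (fun i => (blockAvg (expMeanLogSU (n := n)) : Averaging (F.P K) i (Matrix.specialUnitaryGroup n ℂ))) k (startT3 F K k Ω V (tubeBd F K k ε')) c :
          Matrix.specialUnitaryGroup n ℂ) : Matrix n n ℂ) * star ((V c : Matrix.specialUnitaryGroup n ℂ) : Matrix n n ℂ) - 1‖ ≤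
        2 * ((((F.P K).d : ℝ) + 1) * ((F.P K).L : ℝ) ^ k * (((((F.P K).d * ((F.P K).L ^ k / 2) + (F.P K).L ^ k : ℕ)) : ℝ) * startBd F K k ε'))) := by
  -- sizes
  have hLN : (F.P K).L ^ k ≤ (F.P K).sitesPerDir 0 := by omega
  have hN := hN_of_pow_le (F.P K) k hm hLN
  have hNb := hNb_of_pow_le (F.P K) k hm hLN
  have hNk : (F.P K).sitesPerDir 0 = (F.P K).sitesPerDir k * (F.P K).L ^ k := sitesPerDir_zero_eq_mul_pow hk
  have hRL := two_mul_RbT_add_one_le (F.P K) k hm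
  have hd : 2 ≤ (F.P K).d := by rw [T3Family.P_d]; norm_num
  -- ε′ rows
  have hε4 : ε' ≤ 1 / 4 := by linarith
  have hnπ : (Fintype.card n : ℝ) * ε' < Real.pi := by
    rw [hn2]; push_cast; linarith [Real.pi_gt_three]
  obtain ⟨hb0, -, hR1, -, hsmall, h4800, hπ, hπ'⟩ := startRows (F.P K) k hm hε0 hε5
  have hπn : (Fintype.card n : ℝ) * (200 * (RbT (F.P K) k) * tubeBd F K k ε') < Real.pi := by unfold tubeBd; rw [hn2]; exact_mod_cast hπ
  have hπn' : (Fintype.card n : ℝ) * (20 * (RbT (F.P K) k : ℝ) ^ 2 * tubeBd F K k ε') < Real.pi := by unfold tubeBd; rw [hn2]; exact_mod_cast hπ'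
  -- the tube budget and the log window
  have hf := norm_FpOf_le_of_dist1 F K k Ω V hV
  have htube := htube_of_norm_le k Ω V hf
  have hF := hF_of_dist1 k Ω V hV hε4 hnπ
  -- the shell bound
  have hshell := hshell_of_binders k Ω V hN hb0 hbox_sh hsep_sh hcov_sh htube
  -- (P)
  have hP : ∀ q : Plaq (F.P K) 0, q ∈ plaqsIn 0 Ω → GaugeGroup.dist1 (GaugeField.plaqHol (startT3 F K k Ω V (tubeBd F K k ε')) q) ≤ startBd F K k ε' := fun q hq =>
    dist1_plaqHol_startT3_le F K k Ω V (tubeBd F K k ε') hN hNb hNk hRL hε0 hV hR1 hb0 hsmall h4800 hπn hπn' hshell hbox hsep hcov q hq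
  refine ⟨hP, fun c hc => ?_⟩
  -- (D)
  have hline : ∀ t : ℕ, t < (F.P K).L ^ k → startT3 F K k Ω V (tubeBd F K k ε') ⟨(fun z : Site (F.P K) 0 => z.shift c.dir)^[t] (toFine k c.src), c.dir⟩ =
      iterSec k V ⟨(fun z : Site (F.P K) 0 => z.shift c.dir)^[t] (toFine k c.src), c.dir⟩ := fun t _ =>
    startSys_centre_eq_iterSec hk Ω V (MballT3 F K k Ω V (tubeBd F K k ε')) c hd (RbT_lt_half (F.P K) k hm) (RtT_add_two_le (F.P K) k hm) hN hF t
  exact norm_startDefect_sub_one_le_twoCell hk hN4 (startT3 F K k Ω V (tubeBd F K k ε')) V c (startBd_nonneg F K k hε0)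
    (fun q h1 h2 => hP q (htwo c hc q h1 h2)) hline hmS6 h32 hNδ

end Summit.QuantumFields.YangMills.Theorems.TubeStart

end
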